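import Mathlib
import Summits.Ventures.PercRepro2.LeafHalfCross

/-!
# Row (LEAF-½) reduced to the (A)-terms (blind cell PercRepro2, p5 g25; `proofs/P5-OEDGE.md` §32,
`proofs/subclaims/S4-HARDSTEP.md` v104)

With `LeafHalfCross` (`R½ = halfL + halfH`, `halfL = (P(Q) − m_v)·anticov(oH, bL) + groupL`,
`groupL = crossA + crossB`, `0 ≤ crossB` (THEOREM (B)) and the mirrors by the root swap
`avoidAll_root_swap`), the `a₃`-leaf middle coefficient is

  `R½ = (P(Q) − m_v)·[anticov(oH, bL) + anticov(oL, bH)] + (crossA + crossA′) + (crossB + crossB′)`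

(`Rhalf_eq_four`) with the first group `≥ 0` (BHK06 Thm 1.4, `m_v ≤ P(Q)`) and the third `≥ 0`
(THEOREM (B) and its mirror), so

* `Rhalf_ge_crossA`: `R½ ≥ (P(Q) − m_v)·[anticov(oH, bL) + anticov(oL, bH)] + crossA + crossA′`;
* `LeafRow_of_crossA`: row (LEAF-½) `0 ≤ R½` follows from
  `0 ≤ (P(Q) − m_v)·[anticov(oH, bL) + anticov(oL, bH)] + crossA + crossA′`
  (in words: `(A) + (A′) ≥ −½·μ(v ∉ U)·T₀/P(Q)³`), the open statement of record of the row;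
* `LeafRow_of_G2`: row (LEAF-½) from the two «`G2`» groupings `0 ≤ groupL`, `0 ≤ groupH`
  (`⟺ 0 ≤ crossA + crossB`, `0 ≤ crossA′ + crossB′`), which give the (Q1) margin
  `R½ ≥ (P(Q) − m_v)·[anticov(oH, bL) + anticov(oL, bH)] = ½·μ(v ∉ U)·T₀` (`Rhalf_ge_of_G2`).

None of `0 ≤ crossA`, `0 ≤ crossA + crossB` is claimed: `crossA` has either sign (exact witness in
§32), `crossA + crossB ≥ 0` is census-true only.
-/

namespace Summit.Ventures.PercRepro2

open UnionCluster CovForm PendantRoot LeafStep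

namespace LeafHalfCross

variable {V : Type*} {E : Type*} [Fintype E] [DecidableEq E] [Fintype V] [DecidableEq V]
  {R : Type*} [Field R] [LinearOrder R] [IsStrictOrderedRing R]

section Mirror

variable (p : E → R) (ends : E → Sym2 V)

omit [Fintype V] [DecidableEq V] [LinearOrder R] [IsStrictOrderedRing R] in
/-- `groupH = crossA′ + crossB′`: the `C₂`-half's grouping is the root-swapped (A)-term plus the
root-swapped (B)-term. -/
theorem groupH_eq_crossA_add_crossB (o a₁ a₂ v b : V) :
    groupH p ends o a₁ a₂ v b = crossA p ends o a₂ a₁ v b + crossB p ends o a₂ a₁ v b := by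
  unfold groupH crossA crossB threeC mU anticov
  simp only [avoidAll_root_swap ends a₁ a₂]
  ring

/-- **THEOREM (B), mirrored**: `0 ≤ crossB′` (the roots swapped). -/
theorem crossB_nonneg' (hp : IsProbVec p) (o a₁ a₂ v b : V) :
    0 ≤ crossB p ends o a₂ a₁ v b :=
  crossB_nonneg p ends hp o a₂ a₁ v b

end Mirror

section Reduction

variable (p : E → R) (ends : E → Sym2 V)

omit [Fintype V] in
/-- **Row (LEAF-½) from the two halves**: `0 ≤ halfL → 0 ≤ halfH → LeafRow`. -/
theorem LeafRow_of_halves (o a₁ a₂ v b : V) (hL : 0 ≤ halfL p ends o a₁ a₂ v b)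
    (hH : 0 ≤ halfH p ends o a₁ a₂ v b) : LeafRow p ends o a₁ a₂ v b := by
  unfold LeafRow
  rw [Rhalf_eq_halfL_add_halfH]
  exact add_nonneg hL hH

omit [Fintype V] in
/-- **The four-group form of `R½`**:
`R½ = (P(Q) − m_v)·[anticov(oH, bL) + anticov(oL, bH)] + (crossA + crossA′) + (crossB + crossB′)`. -/
theorem Rhalf_eq_four (o a₁ a₂ v b : V) :
    Rhalf p ends o a₁ a₂ v b =
      (prob p (avoidAll ends a₂ {a₁}) - mU p ends a₁ a₂ v) *
          (anticov p ends a₁ a₂ (connEvent ends a₂ o) (connEvent ends a₁ b) +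
            anticov p ends a₁ a₂ (connEvent ends a₁ o) (connEvent ends a₂ b)) +
        (crossA p ends o a₁ a₂ v b + crossA p ends o a₂ a₁ v b) +
        (crossB p ends o a₁ a₂ v b + crossB p ends o a₂ a₁ v b) := by
  rw [Rhalf_eq_halfL_add_halfH, halfL_eq, halfH_eq, groupL_eq_crossA_add_crossB,
    groupH_eq_crossA_add_crossB]
  ring

/-- **`R½` from below by the (A)-terms**: THEOREM (B) and its mirror give
`R½ ≥ (P(Q) − m_v)·[anticov(oH, bL) + anticov(oL, bH)] + crossA + crossA′`. -/
theorem Rhalf_ge_crossA (hp : IsProbVec p) (o a₁ a₂ v b : V) :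
    (prob p (avoidAll ends a₂ {a₁}) - mU p ends a₁ a₂ v) *
          (anticov p ends a₁ a₂ (connEvent ends a₂ o) (connEvent ends a₁ b) +
            anticov p ends a₁ a₂ (connEvent ends a₁ o) (connEvent ends a₂ b)) +
        (crossA p ends o a₁ a₂ v b + crossA p ends o a₂ a₁ v b) ≤
      Rhalf p ends o a₁ a₂ v b := by
  rw [Rhalf_eq_four]
  have h1 := crossB_nonneg p ends hp o a₁ a₂ v b
  have h2 := crossB_nonneg' p ends hp o a₁ a₂ v b
  linarith

/-- **Row (LEAF-½) from the (A)-terms**: if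
`0 ≤ (P(Q) − m_v)·[anticov(oH, bL) + anticov(oL, bH)] + crossA + crossA′` then `LeafRow`. -/
theorem LeafRow_of_crossA (hp : IsProbVec p) (o a₁ a₂ v b : V)
    (h : 0 ≤ (prob p (avoidAll ends a₂ {a₁}) - mU p ends a₁ a₂ v) *
          (anticov p ends a₁ a₂ (connEvent ends a₂ o) (connEvent ends a₁ b) +
            anticov p ends a₁ a₂ (connEvent ends a₁ o) (connEvent ends a₂ b)) +
        (crossA p ends o a₁ a₂ v b + crossA p ends o a₂ a₁ v b)) :
    LeafRow p ends o a₁ a₂ v b := by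
  unfold LeafRow
  have := Rhalf_ge_crossA p ends hp o a₁ a₂ v b
  linarith

omit [Fintype V] in
/-- **The (Q1) margin from the two «`G2`» groupings**: if `0 ≤ groupL` and `0 ≤ groupH` then
`R½ ≥ (P(Q) − m_v)·[anticov(oH, bL) + anticov(oL, bH)]` (`= ½·μ(v ∉ U)·T₀`). -/
theorem Rhalf_ge_of_G2 (o a₁ a₂ v b : V)
    (hL : 0 ≤ groupL p ends o a₁ a₂ v b) (hH : 0 ≤ groupH p ends o a₁ a₂ v b) :
    (prob p (avoidAll ends a₂ {a₁}) - mU p ends a₁ a₂ v) *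
        (anticov p ends a₁ a₂ (connEvent ends a₂ o) (connEvent ends a₁ b) +
          anticov p ends a₁ a₂ (connEvent ends a₁ o) (connEvent ends a₂ b)) ≤
      Rhalf p ends o a₁ a₂ v b := by
  rw [Rhalf_eq_halfL_add_halfH, halfL_eq, halfH_eq]
  linarith

/-- **Row (LEAF-½) from the two «`G2`» groupings** (`0 ≤ crossA + crossB` on both halves). -/
theorem LeafRow_of_G2 (hp : IsProbVec p) (o a₁ a₂ v b : V)
    (hL : 0 ≤ groupL p ends o a₁ a₂ v b) (hH : 0 ≤ groupH p ends o a₁ a₂ v b) :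
    LeafRow p ends o a₁ a₂ v b := by
  unfold LeafRow
  have h := Rhalf_ge_of_G2 p ends o a₁ a₂ v b hL hH
  have hm := mU_le_Q p ends hp a₁ a₂ v
  have h1 := anticov_nonneg_of_cross' p ends hp a₁ a₂ o b
  have h2 := anticov_nonneg_of_cross p ends hp a₁ a₂ o b
  have : 0 ≤ (prob p (avoidAll ends a₂ {a₁}) - mU p ends a₁ a₂ v) *
      (anticov p ends a₁ a₂ (connEvent ends a₂ o) (connEvent ends a₁ b) +
        anticov p ends a₁ a₂ (connEvent ends a₁ o) (connEvent ends a₂ b)) :=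
    mul_nonneg (sub_nonneg.2 hm) (add_nonneg h1 h2)
  linarith

end Reduction

end LeafHalfCross

end Summit.Ventures.PercRepro2
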